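import Literature.Analysis.FluidPDE.TorusNSGevreyAlgebra
import Literature.Analysis.FluidPDE.TorusClassicalNSTimeDerivLinearised
import Literature.Analysis.FluidPDE.TorusNSGevreySums
import Literature.Analysis.FunctionSpaces.TorusGevreyInterpolation
import Literature.Analysis.FunctionSpaces.TorusScalarTrigPoly
import HarnessLib

/-!
# The Navier–Stokes vector field with the pressure solved: the identities `∂ₜu = G(u)`,
# `∂ₜw = DG(u)[w]`, and Gevrey stability

Analysis/FluidPDE proof file (theorems only; no definitions, no named facts). In the functional form of
the incompressible Navier–Stokes equations on `T^d` (Constantin–Foias 1988, Ch. 5 (5.9)–(5.10);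
Robinson–Rodrigo–Sadowski 2016, Ch. 5) the momentum equation with the pressure solved reads

  `∂ₜu = G(u) := νΔu − P((u·∇)u) + f`,   `P v = v − ∇Δ⁻¹div v`,

and its first variation along `u` (the equation of `w = ∂ₜu`, Temam 1995, §3.4) reads
`∂ₜw = E(u, w) := νΔw − P((u·∇)w + (w·∇)u)`. This file proves:

* `Torus.eq_sub_leray_of_add_eq_sub_gradient` — **pressure elimination**: if `D + N = L − ∇p` pointwise
  with `D`, `L` smooth and divergence free, then `D = L − P N` (the solenoidal part is unique,
  `Torus.gradient_eq_zero_of_isDivFree`); whence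
  `Torus.IsClassicalNSSolutionOn.timeDerivWithin_eq_nsVectorField` (`∂ₜu = G(u)` for classical solutions
  with a smooth divergence-free force) and `Torus.eq_linearisedField_of_linearised` (`∂ₜw = E(u, w)` for
  solutions of the linearised equation);
* `Torus.exists_gevreyBound_nsVectorField`, `Torus.exists_gevreyBound_linearisedField` — **`G` and `E`
  map Gevrey balls into Gevrey balls of half the radius** (the Gevrey algebra of
  `FluidPDE/TorusNSGevreyAlgebra.lean`: Laplacian, product law, Leray contraction, sums);
* `Torus.sum_norm_sq_mFourierCoeff_le_integral_norm_sq`, `Torus.gradNormSq_le_of_forall_sum_le`,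
  `Torus.integral_norm_laplacian_sq_le_of_forall_sum_le` — Parseval bookkeeping between lattice sums and
  `∫‖v‖²`, `‖∇v‖₂²`, `∫‖Δv‖²`;
* `Torus.exists_forall_h2_sub_le_of_gevreyBound` — **on a Gevrey ball, `L²`-closeness forces `H¹`- and
  `H²`-closeness** (`Torus.exists_sobolev_le_of_gevreyBound_of_l2_le`, the Gevrey interpolation).

## Mathlib / tree search

Tree (reused): `TorusNSGevreyAlgebra` (this series), `TorusLerayHelmholtz(H1)`, `TorusNSGevreySums`
(`hasSum_freqNormSq(_sq)_mul_norm_sq_mFourierCoeff`), `TorusVectorParseval`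
(`hasSum_sq_norm_mFourierCoeff_complexify`), `TorusGevreyInterpolation`, `Torus.gradient_fun_add`
(`TorusScalarTrigPoly`), `Torus.fderiv_add/const_smul`, `Torus.divergence_eq_trace_fderiv`. Searched
`nsVectorField`, `timeDerivWithin_eq.*invLaplacian`, `pressure.*leray`: the identity `∂ₜu = G(u)` is not
in the tree (only the modewise/weak forms of `TorusClassicalNSModeDuhamel`, `TorusNSGevreyCoefficients`).

## References

* P. Constantin, C. Foias, *Navier–Stokes Equations*, Univ. Chicago Press 1988, Ch. 5 (5.9)–(5.10).
  [ConstantinFoiasNSE1988]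
* J. C. Robinson, J. L. Rodrigo, W. Sadowski, *The Three-Dimensional Navier–Stokes Equations*, CUP 2016,
  Thm. 2.6, Lemma 2.9, Ch. 5. [RobinsonRodrigoSadowskiCUP2016]
* C. Foias, R. Temam, J. Funct. Anal. 87 (1989) 359–369, Lemma 2.1. [FoiasTemam1989]
-/

noncomputable section

open _root_.MeasureTheory Set Filter Function UnitAddTorus Finset
open scoped Topology BigOperators InnerProductSpace

namespace Literature.Analysis.FluidPDE

namespace Torus

open Literature.Analysis.FunctionSpaces Literature.Analysis.FunctionSpaces.Torus NSGevrey

variable {d : Type*} [Fintype d] [DecidableEq d]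

/-! ### Divergence bookkeeping -/

section Divergence

variable {u v : UnitAddTorus d → EuclideanSpace ℝ d}

/-- `div (u + v) = div u + div v` for `C¹` fields (trace of `D(u + v) = Du + Dv`). [folklore] -/
theorem divergence_fun_add (hu : IsContDiff 1 u) (hv : IsContDiff 1 v) (x : UnitAddTorus d) :
    divergence (fun y => u y + v y) x = divergence u x + divergence v x := by
  rw [show (fun y => u y + v y) = u + v from rfl, divergence_eq_trace_fderiv (hu.add hv),
    divergence_eq_trace_fderiv hu, divergence_eq_trace_fderiv hv, Torus.fderiv_add hu hv,
    ContinuousLinearMap.toLinearMap_add, map_add]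

/-- `div (u − v) = div u − div v` for `C¹` fields. [folklore] -/
theorem divergence_fun_sub (hu : IsContDiff 1 u) (hv : IsContDiff 1 v) (x : UnitAddTorus d) :
    divergence (fun y => u y - v y) x = divergence u x - divergence v x :=
  divergence_sub hu hv x

/-- `div (c • u) = c · div u` for `C¹` fields. [folklore] -/
theorem divergence_const_smul_fun (hu : IsContDiff 1 u) (c : ℝ) (x : UnitAddTorus d) :
    divergence (fun y => c • u y) x = c * divergence u x := by
  rw [show (fun y => c • u y) = c • u from rfl, divergence_eq_trace_fderiv (hu.smul c),
    divergence_eq_trace_fderiv hu, Torus.fderiv_const_smul hu c, ContinuousLinearMap.toLinearMap_smul, map_smul,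
    smul_eq_mul]

/-- Sums of smooth divergence-free fields are divergence free. [folklore] -/
theorem isDivFree_fun_add (hu : IsSmooth u) (hv : IsSmooth v) (hud : IsDivFree u) (hvd : IsDivFree v) :
    IsDivFree (fun y => u y + v y) := fun x => by
  rw [divergence_fun_add (hu.isContDiff (by simp)) (hv.isContDiff (by simp)), hud x, hvd x, add_zero]

/-- Differences of smooth divergence-free fields are divergence free. [folklore] -/
theorem isDivFree_fun_sub (hu : IsSmooth u) (hv : IsSmooth v) (hud : IsDivFree u) (hvd : IsDivFree v) :
    IsDivFree (fun y => u y - v y) := fun x => by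
  rw [divergence_fun_sub (hu.isContDiff (by simp)) (hv.isContDiff (by simp)), hud x, hvd x, sub_zero]

/-- Constant multiples of smooth divergence-free fields are divergence free. [folklore] -/
theorem isDivFree_fun_const_smul (hu : IsSmooth u) (hud : IsDivFree u) (c : ℝ) :
    IsDivFree (fun y => c • u y) := fun x => by
  rw [divergence_const_smul_fun (hu.isContDiff (by simp)), hud x, mul_zero]

end Divergence

/-! ### Pressure elimination: `∂ₜu = G(u)` and `∂ₜw = E(u, w)` -/

section Pressure

variable [Nonempty d]

/-- **Pressure elimination (uniqueness of the solenoidal part).** If `D + N = L − ∇p` pointwise on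
`T^d` with `D`, `L` smooth and divergence free, `N`, `p` smooth, then `D = L − P N` with
`P N = N − ∇Δ⁻¹div N`: indeed `∇(Δ⁻¹div N + p) = (L − D) − P N` is a divergence-free gradient, hence
zero (`Torus.gradient_eq_zero_of_isDivFree`; Robinson–Rodrigo–Sadowski 2016, Thm. 2.6). [folklore] -/
theorem eq_sub_leray_of_add_eq_sub_gradient {D N L : UnitAddTorus d → EuclideanSpace ℝ d}
    {p : UnitAddTorus d → ℝ} (hD : IsSmooth D) (hDdiv : IsDivFree D) (hN : IsSmooth N) (hL : IsSmooth L)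
    (hLdiv : IsDivFree L) (hp : IsSmooth p) (h : ∀ x, D x + N x = L x - Torus.gradient p x) (x : UnitAddTorus d) :
    D x = L x - (N x - Torus.gradient (invLaplacian (divergence N)) x) := by
  set ψ : UnitAddTorus d → ℝ := invLaplacian (divergence N) with hψ
  have hψs : IsSmooth ψ := isSmooth_invLaplacian hN.divergence
  have hP : IsSmooth (fun y => N y - Torus.gradient ψ y) := isSmooth_sub_gradient_invLaplacian_divergence hN
  have hPdiv : IsDivFree (fun y => N y - Torus.gradient ψ y) := isDivFree_sub_gradient_invLaplacian_divergence hN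
  -- `∇(ψ + p) = (L − D) − P N`
  have key : ∀ y, Torus.gradient (fun z => ψ z + p z) y = (L y - D y) - (N y - Torus.gradient ψ y) := by
    intro y
    rw [gradient_fun_add (hψs.isContDiff (by simp)) (hp.isContDiff (by simp))]
    have hy : Torus.gradient p y = L y - (D y + N y) := by rw [h y]; abel
    rw [hy]; abel
  have hgrad : IsDivFree (Torus.gradient fun z => ψ z + p z) := by
    rw [show Torus.gradient (fun z => ψ z + p z) = fun y => (L y - D y) - (N y - Torus.gradient ψ y) from
      funext key]
    exact isDivFree_fun_sub (hL.sub hD) hP (isDivFree_fun_sub hL hD hLdiv hDdiv) hPdiv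
  have hz := congrFun (gradient_eq_zero_of_isDivFree (φ := fun z => ψ z + p z) (hψs.add hp) hgrad) x
  rw [key x, Pi.zero_apply, sub_eq_zero] at hz
  rw [← hz]
  abel

/-- **`∂ₜu = G(u)`: the momentum equation with the pressure solved.** For a classical solution
`(u, p)` of NS_ν on `[a, b] × T^d` (`a < b`) with a smooth divergence-free steady force `f`,
`∂ₜu(t) = νΔu(t) − P((u(t)·∇)u(t)) + f` pointwise for every `t ∈ [a, b]` (one-sided time derivative
within `[a, b]`; `∂ₜu` and `νΔu + f` are divergence free, `Torus.eq_sub_leray_of_add_eq_sub_gradient`;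
Constantin–Foias 1988, (5.9)–(5.10)). [cite: ConstantinFoiasNSE1988, Ch. 5 (5.9)–(5.10)] -/
theorem _root_.Literature.Analysis.FunctionSpaces.Torus.IsClassicalNSSolutionOn.timeDerivWithin_eq_nsVectorField
    {a b ν : ℝ} (hab : a < b) {f : UnitAddTorus d → EuclideanSpace ℝ d} (hf : IsSmooth f) (hfdiv : IsDivFree f)
    {u : ℝ → UnitAddTorus d → EuclideanSpace ℝ d} {p : ℝ → UnitAddTorus d → ℝ}
    (h : IsClassicalNSSolutionOn (Icc a b) ν (fun _ => f) u p) {t : ℝ} (ht : t ∈ Icc a b) (x : UnitAddTorus d) :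
    timeDerivWithin (Icc a b) u t x = ν • laplacian (u t) x -
      (convect (u t) (u t) x - Torus.gradient (invLaplacian (divergence (convect (u t) (u t)))) x) + f x := by
  have hU : UniqueDiffOn ℝ (Icc a b) := uniqueDiffOn_Icc hab
  have hu : IsSmooth (u t) := h.smooth_velocity.isSmooth_slice ht
  have hD : IsSmooth (timeDerivWithin (Icc a b) u t) := h.smooth_velocity.isSmooth_timeDerivWithin hU ht
  have hDdiv : IsDivFree (timeDerivWithin (Icc a b) u t) := h.isDivFree_timeDerivWithin hab ht
  have hL : IsSmooth (fun y => ν • laplacian (u t) y + f y) := (hu.laplacian.smul ν).add hf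
  have hLdiv : IsDivFree (fun y => ν • laplacian (u t) y + f y) :=
    isDivFree_fun_add (hu.laplacian.smul ν) hf
      (isDivFree_fun_const_smul hu.laplacian (IsDivFree.laplacian_of_isSmooth hu (h.divFree t ht)) ν) hfdiv
  have heq : ∀ y, timeDerivWithin (Icc a b) u t y + convect (u t) (u t) y =
      (ν • laplacian (u t) y + f y) - Torus.gradient (p t) y := fun y => by
    rw [h.momentum t ht y]; abel
  rw [eq_sub_leray_of_add_eq_sub_gradient hD hDdiv (hu.convect hu) hL hLdiv (h.smooth_pressure.isSmooth_slice ht)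
    heq x]
  abel

/-- **`∂ₜw = E(u, w)`: the linearised equation with the pressure solved.** If
`D + (u·∇)w + (w·∇)u = νΔw − ∇q` pointwise with `D` smooth divergence free (the time derivative of the
linearised solution), `u`, `w`, `q` smooth and `w` divergence free, then
`D = νΔw − P((u·∇)w + (w·∇)u)` (Temam 1995, §3.4, the equation for `u'`). [folklore] -/
theorem eq_linearisedField_of_linearised {ν : ℝ} {D u w : UnitAddTorus d → EuclideanSpace ℝ d}
    {q : UnitAddTorus d → ℝ} (hD : IsSmooth D) (hDdiv : IsDivFree D) (hu : IsSmooth u) (hw : IsSmooth w)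
    (hwdiv : IsDivFree w) (hq : IsSmooth q)
    (h : ∀ x, D x + convect u w x + convect w u x = ν • laplacian w x - Torus.gradient q x) (x : UnitAddTorus d) :
    D x = ν • laplacian w x - ((convect u w x + convect w u x) -
      Torus.gradient (invLaplacian (divergence fun y => convect u w y + convect w u y)) x) := by
  have hL : IsSmooth (fun y => ν • laplacian w y) := hw.laplacian.smul ν
  have hLdiv : IsDivFree (fun y => ν • laplacian w y) :=
    isDivFree_fun_const_smul hw.laplacian (IsDivFree.laplacian_of_isSmooth hw hwdiv) ν
  have heq : ∀ y, D y + (fun z => convect u w z + convect w u z) y = (fun z => ν • laplacian w z) y -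
      Torus.gradient q y := fun y => by rw [← h y]; dsimp only; abel
  exact eq_sub_leray_of_add_eq_sub_gradient hD hDdiv ((hu.convect hw).add (hw.convect hu)) hL hLdiv hq heq x

end Pressure

/-! ### Fourier coefficients of sums, differences and multiples of real fields -/

section Coeff

variable {a b : UnitAddTorus d → EuclideanSpace ℝ d}

omit [DecidableEq d] in
/-- `‖𝓕(a + b)(k)‖ ≤ ‖â(k)‖ + ‖b̂(k)‖` for integrable real fields. [folklore] -/
theorem norm_mFourierCoeff_complexify_add_le (ha : Integrable a volume) (hb : Integrable b volume) (k : d → ℤ) :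
    ‖mFourierCoeff (EuclideanSpace.complexify ∘ fun x => a x + b x) k‖ ≤
      ‖mFourierCoeff (EuclideanSpace.complexify ∘ a) k‖ + ‖mFourierCoeff (EuclideanSpace.complexify ∘ b) k‖ := by
  have hfun : (EuclideanSpace.complexify ∘ fun x => a x + b x) =
      (EuclideanSpace.complexify ∘ a) + (EuclideanSpace.complexify ∘ b) := by
    funext x; simp only [Function.comp_apply, Pi.add_apply, map_add]
  rw [hfun, mFourierCoeff_add (integrable_complexify_comp ha) (integrable_complexify_comp hb)]
  exact norm_add_le _ _

omit [DecidableEq d] in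
/-- `‖𝓕(a − b)(k)‖ ≤ ‖â(k)‖ + ‖b̂(k)‖` for integrable real fields. [folklore] -/
theorem norm_mFourierCoeff_complexify_sub_le (ha : Integrable a volume) (hb : Integrable b volume) (k : d → ℤ) :
    ‖mFourierCoeff (EuclideanSpace.complexify ∘ fun x => a x - b x) k‖ ≤
      ‖mFourierCoeff (EuclideanSpace.complexify ∘ a) k‖ + ‖mFourierCoeff (EuclideanSpace.complexify ∘ b) k‖ := by
  have hfun : (EuclideanSpace.complexify ∘ fun x => a x - b x) =
      (EuclideanSpace.complexify ∘ a) - (EuclideanSpace.complexify ∘ b) := by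
    funext x; simp only [Function.comp_apply, Pi.sub_apply, map_sub]
  rw [hfun, mFourierCoeff_sub (integrable_complexify_comp ha) (integrable_complexify_comp hb)]
  exact norm_sub_le _ _

omit [DecidableEq d] in
/-- `‖𝓕(c • a)(k)‖ = |c| ‖â(k)‖` for a real constant `c`. [folklore] -/
theorem norm_mFourierCoeff_complexify_const_smul (c : ℝ) (a : UnitAddTorus d → EuclideanSpace ℝ d) (k : d → ℤ) :
    ‖mFourierCoeff (EuclideanSpace.complexify ∘ fun x => c • a x) k‖ =
      |c| * ‖mFourierCoeff (EuclideanSpace.complexify ∘ a) k‖ := by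
  have hfun : (EuclideanSpace.complexify ∘ fun x => c • a x) = (c : ℂ) • (EuclideanSpace.complexify ∘ a) := by
    funext x
    simp only [Function.comp_apply, Pi.smul_apply]
    ext i
    simp [EuclideanSpace.complexify_apply]
  rw [hfun, mFourierCoeff_const_smul, norm_smul, Complex.norm_real, Real.norm_eq_abs]

end Coeff

/-! ### `G` and `E` map Gevrey balls into Gevrey balls -/

section Gevrey

variable [Nonempty d]

/-- **The Navier–Stokes vector field maps Gevrey balls into Gevrey balls.** For `ν`, a radius
`σ > 0` and levels `C_u`, `C_f` there is `C'` such that for all smooth `u`, `f` with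
`∑_{k∈S} e^{2σ|k|} ‖û(k)‖² ≤ C_u` and `∑_{k∈S} e^{σ|k|} ‖f̂(k)‖² ≤ C_f` (all finite `S`), the field
`G(u) = νΔu − P((u·∇)u) + f` obeys `∑_{k∈S} e^{σ|k|} ‖𝓕(G(u))(k)‖² ≤ C'` for all finite `S` (the Gevrey
algebra: `Torus.gevreyBound_laplacian`, `Torus.gevreyBound_convect`, `Torus.gevreyBound_leray`,
`Torus.gevreyBound_of_norm_le_add`; Foias–Temam 1989, Lemma 2.1). [folklore] -/
theorem exists_gevreyBound_nsVectorField (ν σ Cu Cf : ℝ) (hσ : 0 < σ) :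
    ∃ C' : ℝ, ∀ (u f : UnitAddTorus d → EuclideanSpace ℝ d), IsSmooth u → IsSmooth f →
      (∀ S : Finset (d → ℤ), ∑ k ∈ S, Real.exp (2 * σ * Real.sqrt (freqNormSq k)) *
        ‖mFourierCoeff (EuclideanSpace.complexify ∘ u) k‖ ^ 2 ≤ Cu) →
      (∀ S : Finset (d → ℤ), ∑ k ∈ S, Real.exp (2 * (σ / 2) * Real.sqrt (freqNormSq k)) *
        ‖mFourierCoeff (EuclideanSpace.complexify ∘ f) k‖ ^ 2 ≤ Cf) →
      ∀ S : Finset (d → ℤ), ∑ k ∈ S, Real.exp (2 * (σ / 2) * Real.sqrt (freqNormSq k)) *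
        ‖mFourierCoeff (EuclideanSpace.complexify ∘ fun x => ν • laplacian u x -
          (convect u u x - Torus.gradient (invLaplacian (divergence (convect u u))) x) + f x) k‖ ^ 2 ≤ C' := by
  set Z : ℝ := ∑' m : d → ℤ, (1 + freqNormSq m) ^ 1 * Real.exp (-(σ / 2 * Real.sqrt (freqNormSq m))) with hZ
  set A : ℝ := (|ν| * (4 * Real.pi ^ 2)) ^ 2 * ((2 * (2 * 1)).factorial / σ ^ (2 * (2 * 1)) * Real.exp σ) * Cu with hA
  set B : ℝ := (2 * Real.pi * (Fintype.card d : ℝ) ^ 2 * (2 * Real.sqrt Cu * Z) * (2 * Real.sqrt Cu * Z)) ^ 2 with hB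
  refine ⟨2 * (2 * A + 2 * B) + 2 * Cf, fun u f hu hf hGu hGf S => ?_⟩
  have hN : IsSmooth (convect u u) := hu.convect hu
  have hPN : IsSmooth (fun x => convect u u x - Torus.gradient (invLaplacian (divergence (convect u u))) x) :=
    isSmooth_sub_gradient_invLaplacian_divergence hN
  have hΔ : IsSmooth (fun x => ν • laplacian u x) := hu.laplacian.smul ν
  -- the three Gevrey bounds at radius `σ/2`
  have h1 : ∀ S : Finset (d → ℤ), ∑ k ∈ S, Real.exp (2 * (σ / 2) * Real.sqrt (freqNormSq k)) *
      ‖mFourierCoeff (EuclideanSpace.complexify ∘ fun x => ν • laplacian u x) k‖ ^ 2 ≤ A := by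
    refine gevreyBound_of_norm_le_weight_mul (m := 1) hσ (fun k => ?_) hGu
    rw [norm_mFourierCoeff_complexify_const_smul, pow_one, mul_assoc, mul_assoc]
    refine mul_le_mul_of_nonneg_left ?_ (abs_nonneg ν)
    rw [← mul_assoc]
    exact norm_mFourierCoeff_complexify_laplacian_le hu k
  have h2 : ∀ S : Finset (d → ℤ), ∑ k ∈ S, Real.exp (2 * (σ / 2) * Real.sqrt (freqNormSq k)) *
      ‖mFourierCoeff (EuclideanSpace.complexify ∘ fun x =>
        convect u u x - Torus.gradient (invLaplacian (divergence (convect u u))) x) k‖ ^ 2 ≤ B :=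
    gevreyBound_leray hN (gevreyBound_convect hσ hu hu hGu hGu)
  have h12 := gevreyBound_of_norm_le_add (fun k => norm_mFourierCoeff_complexify_sub_le hΔ.integrable
    hPN.integrable k) h1 h2
  exact gevreyBound_of_norm_le_add (fun k => norm_mFourierCoeff_complexify_add_le (hΔ.sub hPN).integrable
    hf.integrable k) h12 hGf S

/-- **The linearised field maps Gevrey balls into Gevrey balls.** For `ν`, `σ > 0`, `C_u`, `C_w` there is
`C'` such that for all smooth `u`, `w` with Gevrey bounds of radius `σ` and levels `C_u`, `C_w`, the field
`E(u, w) = νΔw − P((u·∇)w + (w·∇)u)` obeys `∑_{k∈S} e^{σ|k|} ‖𝓕(E(u, w))(k)‖² ≤ C'` for all finite `S`.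
[folklore] -/
theorem exists_gevreyBound_linearisedField (ν σ Cu Cw : ℝ) (hσ : 0 < σ) :
    ∃ C' : ℝ, ∀ (u w : UnitAddTorus d → EuclideanSpace ℝ d), IsSmooth u → IsSmooth w →
      (∀ S : Finset (d → ℤ), ∑ k ∈ S, Real.exp (2 * σ * Real.sqrt (freqNormSq k)) *
        ‖mFourierCoeff (EuclideanSpace.complexify ∘ u) k‖ ^ 2 ≤ Cu) →
      (∀ S : Finset (d → ℤ), ∑ k ∈ S, Real.exp (2 * σ * Real.sqrt (freqNormSq k)) *
        ‖mFourierCoeff (EuclideanSpace.complexify ∘ w) k‖ ^ 2 ≤ Cw) →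
      ∀ S : Finset (d → ℤ), ∑ k ∈ S, Real.exp (2 * (σ / 2) * Real.sqrt (freqNormSq k)) *
        ‖mFourierCoeff (EuclideanSpace.complexify ∘ fun x => ν • laplacian w x -
          ((convect u w x + convect w u x) -
            Torus.gradient (invLaplacian (divergence fun y => convect u w y + convect w u y)) x)) k‖ ^ 2 ≤ C' := by
  set Z : ℝ := ∑' m : d → ℤ, (1 + freqNormSq m) ^ 1 * Real.exp (-(σ / 2 * Real.sqrt (freqNormSq m))) with hZ
  set A : ℝ := (|ν| * (4 * Real.pi ^ 2)) ^ 2 * ((2 * (2 * 1)).factorial / σ ^ (2 * (2 * 1)) * Real.exp σ) * Cw with hA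
  set B₁ : ℝ := (2 * Real.pi * (Fintype.card d : ℝ) ^ 2 * (2 * Real.sqrt Cu * Z) * (2 * Real.sqrt Cw * Z)) ^ 2 with hB₁
  set B₂ : ℝ := (2 * Real.pi * (Fintype.card d : ℝ) ^ 2 * (2 * Real.sqrt Cw * Z) * (2 * Real.sqrt Cu * Z)) ^ 2 with hB₂
  refine ⟨2 * A + 2 * (2 * B₁ + 2 * B₂), fun u w hu hw hGu hGw S => ?_⟩
  have hN : IsSmooth (fun y => convect u w y + convect w u y) := (hu.convect hw).add (hw.convect hu)
  have hPN : IsSmooth (fun x => (convect u w x + convect w u x) -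
      Torus.gradient (invLaplacian (divergence fun y => convect u w y + convect w u y)) x) :=
    isSmooth_sub_gradient_invLaplacian_divergence hN
  have hΔ : IsSmooth (fun x => ν • laplacian w x) := hw.laplacian.smul ν
  have h1 : ∀ S : Finset (d → ℤ), ∑ k ∈ S, Real.exp (2 * (σ / 2) * Real.sqrt (freqNormSq k)) *
      ‖mFourierCoeff (EuclideanSpace.complexify ∘ fun x => ν • laplacian w x) k‖ ^ 2 ≤ A := by
    refine gevreyBound_of_norm_le_weight_mul (m := 1) hσ (fun k => ?_) hGw
    rw [norm_mFourierCoeff_complexify_const_smul, pow_one, mul_assoc, mul_assoc]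
    refine mul_le_mul_of_nonneg_left ?_ (abs_nonneg ν)
    rw [← mul_assoc]
    exact norm_mFourierCoeff_complexify_laplacian_le hw k
  have hNb : ∀ S : Finset (d → ℤ), ∑ k ∈ S, Real.exp (2 * (σ / 2) * Real.sqrt (freqNormSq k)) *
      ‖mFourierCoeff (EuclideanSpace.complexify ∘ fun y => convect u w y + convect w u y) k‖ ^ 2 ≤ 2 * B₁ + 2 * B₂ :=
    gevreyBound_of_norm_le_add (fun k => norm_mFourierCoeff_complexify_add_le (hu.convect hw).integrable
      (hw.convect hu).integrable k) (gevreyBound_convect hσ hu hw hGu hGw) (gevreyBound_convect hσ hw hu hGw hGu)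
  have h2 := gevreyBound_leray hN hNb
  exact gevreyBound_of_norm_le_add (fun k => norm_mFourierCoeff_complexify_sub_le hΔ.integrable
    hPN.integrable k) h1 h2 S

end Gevrey

/-! ### Lattice sums versus `L²`, `Ḣ¹`, `Ḣ²` -/

section Parseval

variable {v : UnitAddTorus d → EuclideanSpace ℝ d}

omit [DecidableEq d] in
/-- Partial Parseval sums: `∑_{k∈S} ‖v̂(k)‖² ≤ ∫ ‖v‖²` for smooth `v`. [folklore] -/
theorem sum_norm_sq_mFourierCoeff_le_integral_norm_sq (hv : IsSmooth v) (S : Finset (d → ℤ)) :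
    ∑ k ∈ S, ‖mFourierCoeff (EuclideanSpace.complexify ∘ v) k‖ ^ 2 ≤ ∫ x, ‖v x‖ ^ 2 :=
  sum_le_hasSum S (fun _ _ => sq_nonneg _) (hasSum_sq_norm_mFourierCoeff_complexify (hv.memLp 2))

/-- **`Ḣ¹` from the first Sobolev sum**: if `∑_{k∈S} (1 + |k|²) ‖v̂(k)‖² ≤ ε` for all finite `S` then
`‖∇v‖₂² ≤ 4π² ε` (`‖∇v‖₂² = ∑ 4π²|k|² ‖v̂‖²`, `Torus.hasSum_freqNormSq_mul_norm_sq_mFourierCoeff`). [folklore] -/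
theorem gradNormSq_le_of_forall_sum_le (hv : IsSmooth v) {ε : ℝ}
    (h : ∀ S : Finset (d → ℤ), ∑ k ∈ S, (1 + freqNormSq k) ^ 1 *
      ‖mFourierCoeff (EuclideanSpace.complexify ∘ v) k‖ ^ 2 ≤ ε) :
    gradNormSq v ≤ 4 * Real.pi ^ 2 * ε := by
  refine hasSum_le_of_sum_le (hasSum_freqNormSq_mul_norm_sq_mFourierCoeff hv) fun S => ?_
  calc ∑ k ∈ S, 4 * Real.pi ^ 2 * freqNormSq k * ‖mFourierCoeff (EuclideanSpace.complexify ∘ v) k‖ ^ 2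
      ≤ ∑ k ∈ S, 4 * Real.pi ^ 2 * ((1 + freqNormSq k) ^ 1 * ‖mFourierCoeff (EuclideanSpace.complexify ∘ v) k‖ ^ 2) :=
        Finset.sum_le_sum fun k _ => by
          rw [pow_one, mul_assoc]
          refine mul_le_mul_of_nonneg_left (mul_le_mul_of_nonneg_right (by linarith) (sq_nonneg _)) ?_
          positivity
    _ = 4 * Real.pi ^ 2 * ∑ k ∈ S, (1 + freqNormSq k) ^ 1 * ‖mFourierCoeff (EuclideanSpace.complexify ∘ v) k‖ ^ 2 := by
        rw [Finset.mul_sum]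
    _ ≤ 4 * Real.pi ^ 2 * ε := mul_le_mul_of_nonneg_left (h S) (by positivity)

/-- **`Ḣ²` from the second Sobolev sum**: if `∑_{k∈S} (1 + |k|²)² ‖v̂(k)‖² ≤ ε` for all finite `S` then
`∫ ‖Δv‖² ≤ (4π²)² ε` (`∫‖Δv‖² = ∑ (4π²|k|²)² ‖v̂‖²`, `Torus.hasSum_freqNormSq_sq_mul_norm_sq_mFourierCoeff`).
[folklore] -/
theorem integral_norm_laplacian_sq_le_of_forall_sum_le (hv : IsSmooth v) {ε : ℝ}
    (h : ∀ S : Finset (d → ℤ), ∑ k ∈ S, (1 + freqNormSq k) ^ 2 *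
      ‖mFourierCoeff (EuclideanSpace.complexify ∘ v) k‖ ^ 2 ≤ ε) :
    ∫ x, ‖laplacian v x‖ ^ 2 ≤ (4 * Real.pi ^ 2) ^ 2 * ε := by
  refine hasSum_le_of_sum_le (hasSum_freqNormSq_sq_mul_norm_sq_mFourierCoeff hv) fun S => ?_
  have hterm : ∀ k : d → ℤ, (4 * Real.pi ^ 2 * freqNormSq k) ^ 2 *
      ‖mFourierCoeff (EuclideanSpace.complexify ∘ v) k‖ ^ 2 ≤
      (4 * Real.pi ^ 2) ^ 2 * ((1 + freqNormSq k) ^ 2 * ‖mFourierCoeff (EuclideanSpace.complexify ∘ v) k‖ ^ 2) := by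
    intro k
    have h0 := freqNormSq_nonneg k
    have h1 : freqNormSq k ^ 2 ≤ (1 + freqNormSq k) ^ 2 := pow_le_pow_left₀ h0 (by linarith) 2
    rw [mul_pow, mul_assoc]
    exact mul_le_mul_of_nonneg_left (mul_le_mul_of_nonneg_right h1 (sq_nonneg _)) (by positivity)
  calc ∑ k ∈ S, (4 * Real.pi ^ 2 * freqNormSq k) ^ 2 * ‖mFourierCoeff (EuclideanSpace.complexify ∘ v) k‖ ^ 2
      ≤ ∑ k ∈ S, (4 * Real.pi ^ 2) ^ 2 *
          ((1 + freqNormSq k) ^ 2 * ‖mFourierCoeff (EuclideanSpace.complexify ∘ v) k‖ ^ 2) :=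
        Finset.sum_le_sum fun k _ => hterm k
    _ = (4 * Real.pi ^ 2) ^ 2 * ∑ k ∈ S, (1 + freqNormSq k) ^ 2 * ‖mFourierCoeff (EuclideanSpace.complexify ∘ v) k‖ ^ 2 := by
        rw [Finset.mul_sum]
    _ ≤ (4 * Real.pi ^ 2) ^ 2 * ε := mul_le_mul_of_nonneg_left (h S) (by positivity)

/-- **On a Gevrey ball, `L²`-closeness forces `Ḣ¹`- and `Ḣ²`-closeness** (Foias–Temam 1989 Gevrey classes;
the interpolation `Torus.exists_sobolev_le_of_gevreyBound_of_l2_le`): for `σ > 0`, `C` and `ε > 0` there is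
`δ > 0` such that any two smooth fields `v₁`, `v₂` with Gevrey bounds of radius `σ` and level `C` and
`∫ ‖v₁ − v₂‖² ≤ δ` satisfy `‖∇(v₁ − v₂)‖₂² ≤ ε` and `∫ ‖Δ(v₁ − v₂)‖² ≤ ε` (the coefficients of `v₁ − v₂`
have the Gevrey bound `4C` and `ℓ²`-sum `≤ δ`). [folklore] -/
theorem exists_forall_h2_sub_le_of_gevreyBound (σ C : ℝ) (hσ : 0 < σ) {ε : ℝ} (hε : 0 < ε) :
    ∃ δ : ℝ, 0 < δ ∧ ∀ (v₁ v₂ : UnitAddTorus d → EuclideanSpace ℝ d), IsSmooth v₁ → IsSmooth v₂ →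
      (∀ S : Finset (d → ℤ), ∑ k ∈ S, Real.exp (2 * σ * Real.sqrt (freqNormSq k)) *
        ‖mFourierCoeff (EuclideanSpace.complexify ∘ v₁) k‖ ^ 2 ≤ C) →
      (∀ S : Finset (d → ℤ), ∑ k ∈ S, Real.exp (2 * σ * Real.sqrt (freqNormSq k)) *
        ‖mFourierCoeff (EuclideanSpace.complexify ∘ v₂) k‖ ^ 2 ≤ C) →
      (∫ x, ‖v₁ x - v₂ x‖ ^ 2) ≤ δ →
      gradNormSq (fun x => v₁ x - v₂ x) ≤ ε ∧ (∫ x, ‖laplacian (fun y => v₁ y - v₂ y) x‖ ^ 2) ≤ ε := by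
  by_cases hC : 0 ≤ C
  swap
  · refine ⟨1, one_pos, fun v₁ v₂ _ _ hG₁ _ _ => absurd (gevreyBound_nonneg hG₁) hC⟩
  have hG : 0 ≤ 2 * C + 2 * C := by linarith
  have hε₁ : 0 < ε / (4 * Real.pi ^ 2) := by positivity
  have hε₂ : 0 < ε / (4 * Real.pi ^ 2) ^ 2 := by positivity
  obtain ⟨δ₁, hδ₁, h₁⟩ := exists_sobolev_le_of_gevreyBound_of_l2_le (d := d) (V := EuclideanSpace ℂ d) σ
    (2 * C + 2 * C) hσ hG 1 _ hε₁
  obtain ⟨δ₂, hδ₂, h₂⟩ := exists_sobolev_le_of_gevreyBound_of_l2_le (d := d) (V := EuclideanSpace ℂ d) σ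
    (2 * C + 2 * C) hσ hG 2 _ hε₂
  refine ⟨min δ₁ δ₂, lt_min hδ₁ hδ₂, fun v₁ v₂ hv₁ hv₂ hG₁ hG₂ hL2 => ?_⟩
  have hδ : IsSmooth (fun x => v₁ x - v₂ x) := hv₁.sub hv₂
  have hGδ := gevreyBound_of_norm_le_add (fun k => norm_mFourierCoeff_complexify_sub_le hv₁.integrable
    hv₂.integrable k) hG₁ hG₂
  have hl2 : ∀ S : Finset (d → ℤ), ∑ k ∈ S, ‖mFourierCoeff (EuclideanSpace.complexify ∘ fun x => v₁ x - v₂ x) k‖ ^ 2 ≤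
      min δ₁ δ₂ := fun S => (sum_norm_sq_mFourierCoeff_le_integral_norm_sq hδ S).trans hL2
  have hs₁ := h₁ _ hGδ (fun S => (hl2 S).trans (min_le_left _ _))
  have hs₂ := h₂ _ hGδ (fun S => (hl2 S).trans (min_le_right _ _))
  refine ⟨(gradNormSq_le_of_forall_sum_le hδ hs₁).trans (le_of_eq ?_),
    (integral_norm_laplacian_sq_le_of_forall_sum_le hδ hs₂).trans (le_of_eq ?_)⟩
  · field_simp
  · field_simp

end Parseval

end Torus

end Literature.Analysis.FluidPDE

end
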